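import Summits.BirchSwinnertonDyer.BirchSwinnertonDyer.Theorems.SmallImageMuTransferMuTransferX9SelmerDualAssembly
import Summits.BirchSwinnertonDyer.BirchSwinnertonDyer.Theorems.SmallImageMuTransferMuTransferX9SelmerDualLocalBad
import Summits.BirchSwinnertonDyer.BirchSwinnertonDyer.Theorems.SmallImageMuTransferMuTransferX9CoresUnramifiedAt
import Summits.BirchSwinnertonDyer.BirchSwinnertonDyer.Theorems.SmallImageMuTransferMuTransferX9KolyvaginClassTwistUnramified
import Literature.NumberTheory.EllipticCurves.Castella2018.AnticyclotomicSelmerDualModuleFinite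
import Literature.NumberTheory.EllipticCurves.SelmerGroupOverTorsionFinite
import HarnessLib

/-!
# K6 crux `MuTransferX9` (stmt-BirchSwinnertonDyer-19276), stub `stub_selmerDualOdd` (skeleton v6):
# the local clause (L-ur) — `loc_v Ψ` is UNRAMIFIED at every good `v ∤ p` for the dual test class
# `Ψ` built from a fine `y` — PROVED, and the stub re-assembled from (L-p) ALONE

Cell `bsd-smallim`, seat `bsd-smallim-k6-lur-a` (gen 0, strategy A). HONEST FRAMING: theorems only (no
definition, no named fact, no `sorry`); nothing is asserted about any curve and nothing is booked. This
file serves the registered stub `stub_selmerDualOdd` (skeleton v6, sha16 a90a661b046bb403) of crux 19276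
through k6-c2's assembly `SelmerDual.stub_selmerDualOdd_of_local (hLbad) (hLp) (hLur)` (p456301):

* `SelmerDual.localUnramified` — hypothesis `hLur` of that assembly WITH ONE EXTRA BINDER
  `W.HasGoodReductionAt v` (inserted right after `GaloisRep.IsUnramifiedAt v (W.torsionGaloisModule p)`;
  binder shape approved by the cell planner, STATUS 2026-08-26T18:15Z (1)).  The verbatim `hLur` omits good
  reduction, which the argument needs (the reduction step AEC VIII.1.4 of the tree's Castella (B′)) and
  without which the statement is not expected to hold (at a multiplicative `v` with `p ∣ ord_v(Δ)` the
  module `E[p]` is unramified while the Kummer class of the Tate parameter in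
  `ker (H¹(ℚ_{∞,w}, E[p]) → H¹(ℚ_{∞,w}, E[p^∞]))` is ramified; witness shape `k = 0`, `J + 1 = p^n`).
  The assembly already holds `W.HasGoodReductionAt v` at the point of use (the discarded middle component
  of `TorsionUnramified.exists_finite_superset_isUnramifiedAt_torsionGaloisModule`), so nothing is lost:
* `SelmerDual.stub_selmerDualOdd_of_localP (hLp)` — the registered stub VERBATIM from the single
  remaining local hypothesis (L-p) (k6-c2's `hLp`, byte-identical), with (L-bad) discharged by
  `SelmerDual.localBad` (p456573) and (L-ur) by `localUnramified`.

THE PROOF of (L-ur) (MU-TRANSFER-PROOF §5 STEP 1, "`y` fine ⟹ `c'` unramified off `S`"), for the data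
`y ↦ y_n ↦ Y = Sh⁻¹(y_n) ↦ Ψ` (`ι_* Ψ = T^k Y`, `ι = T^{p^n−J−1}·`) of the assembly:
1. `y` fine ⟹ `res_{I_𝔓} y = 0` for every prime `𝔓 ∣ v` (the fine condition off `p` is local TRIVIALITY
   of the `E[p^∞]`-class at every place of `ℚ_∞` above `v`, `GreenbergSelmer.awayKer` after every
   `conj_σ`; Castella (B′) `resOfLe_torsion_eq_zero_of_forall_conjH1_mem_awayKer`, which is where good
   reduction enters; `I_𝔓 ≤ Gal(ℚ̄/ℚ_∞)` by `ZpExtension.inertia_le_kerSubgroup_holds`, Washington 13.2);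
   transported to `y_n` along `res y_n = y` and made pointwise on cocycles (`I_𝔓` acts trivially on `E[p]`).
2. `Y = coresShapiro n y_n` keeps a cocycle vanishing on every `I_𝔓`, `𝔓 ∣ v` — x9's
   `CoresUnramified.exists_cocycle_coresShapiro_apply_eq_zero_of_forall_primesAbove` (p459441).
3. `ι_* Ψ = T^k Y` on cocycles: `ι ∘ ψ − S^k ∘ F` is a coboundary, which vanishes on `I_𝔓` since `I_𝔓`
   acts trivially on `𝒯_{p^n}(E, κ⁻¹)` (`E[p]` unramified, `I_𝔓 ≤ Γ_n`: `twistModP_apply_of_mem_layerSubgroup`);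
   `ι` is injective on values (`shiftEmbed_eq_zero`), so `ψ` vanishes on `I_𝔓`.
4. A global cocycle vanishing on `I_{𝔓₀}` has unramified localisation — k6-g3's
   `KolyvaginTwist.localization_mem_unramifiedSubgroup_of_forall_inertia_apply_eq_zero` (p456201).

PARTITION (D-0054): X9 (A4) × p ∈ {5,7} (+ X10b∧¬Surj at p = 3 via v6) — helper toward `stub_selmerDualOdd`;
closes none (after this file the stub's open content is (L-p) exactly).

References: HOME/koly/MU-TRANSFER-PROOF.md §5 STEP 1 / (F6); J. H. Silverman, *AEC* X.4 Cor. 4.4 and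
VIII.1.4 [SilvermanAEC2009]; L. Washington, *Introduction to Cyclotomic Fields* Prop. 13.2 [Washington1997];
J.-P. Serre, *Galois Cohomology* I §2.5 [SerreGaloisCohomology1997]; J. S. Milne, *ADT* I §2 [MilneADT2006];
R. Greenberg, LNM 1716 §3 [GreenbergLNM1716].
-/

set_option linter.dupNamespace false
set_option autoImplicit false

noncomputable section

open scoped Classical NumberField
open Field IsDedekindDomain
open WeierstrassCurve (geomTorsion geomPrimaryTorsion)
open Literature.NumberTheory.GaloisRepresentations
open Literature.NumberTheory.GaloisCohomology
open Literature.NumberTheory.EllipticCurves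

universe u

namespace Summit.BirchSwinnertonDyer.BirchSwinnertonDyer.Rank1Residual.SelmerDual

/-! ## The `T`-embedding is injective on values -/

/-- The `T^{J−J'}`-embedding `𝒯_{J'} → 𝒯_J` (`ZpExtension.shiftEmbed`, `x ↦ T^{J−J'}·x`) is injective on
values: `T^{J−J'} x = 0 ⟹ x = 0` (read the coordinate `i + (J − J')`). [cite: Washington1997, §13.1–§13.2] -/
theorem shiftEmbed_eq_zero {M : Type u} [AddCommGroup M] {J J' : ℕ} (hJ' : J' ≤ J) {x : Fin J' → M}
    (hx : ZpExtension.shiftEmbed J hJ' x = 0) : x = 0 := by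
  funext i
  have h := congrFun hx ⟨(i : ℕ) + (J - J'), by omega⟩
  rw [ZpExtension.shiftEmbed_apply, dif_pos (by simp only; omega)] at h
  simpa using h

/-! ## From `ι_* Ψ = T^k Y` on classes to cocycles: `Ψ` vanishes where a cocycle of `Y` does -/

section Avatar

variable {K : Type u} [Field K] {p : ℕ} [Fact p.Prime] (κ : ZpExtension K p)
  {M : Type u} [AddCommGroup M] [TopologicalSpace M] [DiscreteTopology M]
  (ρ : DiscreteGaloisModule K M) (hM : ∀ x : M, p • x = 0)

/-- **The avatar `Ψ` of exact level inherits pointwise vanishing from `Y`.**  If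
`H¹(T^{J−J'}·) [ψ] = T^[k] [F]` in `H¹(K, 𝒯_J)` and `F` vanishes on a set `I ⊆ Γ_K` acting trivially on
`𝒯_J`, then `ψ` vanishes on `I`: the difference `T^{J−J'}∘ψ − S^k∘F` is a coboundary `g ↦ g•m − m`, zero
on `I`, and `T^{J−J'}·` is injective on values. [cite: SerreGaloisCohomology1997, I §2.2] -/
theorem apply_eq_zero_of_map_shiftEmbed_eq_shiftH1_iterate {J J' : ℕ} (hJ' : J' ≤ J) (k : ℕ)
    (ψ : contOneCocycles (κ.twistModP ρ hM J').toTopRep) (F : contOneCocycles (κ.twistModP ρ hM J).toTopRep)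
    (h : galoisCohomology.map (κ.twistModPShiftEmbed ρ hM J hJ') 1 (oneCocycleClass _ ψ) =
      (κ.shiftH1 ρ hM J)^[k] (oneCocycleClass _ F))
    {I : Set (absoluteGaloisGroup K)} (hI : ∀ τ ∈ I, ∀ x : Fin J → M, κ.twistModP ρ hM J τ x = x)
    (hF : ∀ τ ∈ I, F.1 τ = 0) : ∀ τ ∈ I, ψ.1 τ = 0 := by
  intro τ hτ
  have hcl : oneCocycleClass (κ.twistModP ρ hM J).toTopRep
      (κ.pushCocycle ρ hM J' (κ.twistModPShiftEmbed ρ hM J hJ') ψ - κ.shiftPowCocycle ρ hM J k F) = 0 := by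
    rw [oneCocycleClass_sub, sub_eq_zero, ← κ.map_oneCocycleClass_twist ρ hM J', h,
      κ.shiftH1_iterate_oneCocycleClass ρ hM J k F]
  obtain ⟨m, hm⟩ := (oneCocycleClass_eq_zero_iff _ _).1 hcl
  have key := hm τ
  rw [Submodule.coe_sub, ContinuousMap.sub_apply, ZpExtension.pushCocycle_apply,
    ZpExtension.shiftPowCocycle_apply, hF τ hτ, map_zero, sub_zero, ContinuousRep.toTopRep_ρ_apply,
    hI τ hτ, sub_self] at key
  exact shiftEmbed_eq_zero hJ' key

end Avatar

/-! ## (L-ur): `loc_v Ψ` is unramified at every good `v ∤ p` -/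

/-- **(L-ur) of `stub_selmerDualOdd_of_local`, with the binder `W.HasGoodReductionAt v` added** (see the
module docstring for why the verbatim binder is not a target): for the cyclotomic data of the stub, a finite
place `v ∤ p` of `ℚ` at which `E[p]` is unramified AND `E` has good reduction, a fine class
`y ∈ H¹(ℚ_∞, E[p])` and the data `y_n, Y, Ψ, k` tied to `y` by the assembly's three relations
(`res y_n = res y`, `Sh(Y) = y_n`, `T^{p^n−J−1}· Ψ = T^k Y`), the localisation of `Ψ` at `v` lies in
`H¹_ur(ℚ_v, 𝒯_{J+1}(E, κ⁻¹))`.  Steps: fine ⟹ `res_{I_𝔓} y = 0` (Castella (B′), AEC X.4.4 / VIII.1.4;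
`I_𝔓 ≤ Gal(ℚ̄/ℚ_∞)`, Washington 13.2) ⟹ a cocycle of `y_n` vanishes on every `Γ_n ∩ I_𝔓` ⟹ so does one of
`Y = coresShapiro n y_n` (x9 `CoresUnramified`) ⟹ so does every cocycle of `Ψ` (coboundaries die on `I_𝔓`,
`T`-embedding injective) ⟹ `loc_v Ψ ∈ H¹_ur` (k6-g3 `KolyvaginTwist`).
[cite: SilvermanAEC2009, Cor. X.4.4 (proof of Thm. X.4.2(b))] [cite: Washington1997, Prop. 13.2]
[cite: SerreGaloisCohomology1997, I §2.5 Prop. 10] [cite: MilneADT2006, Ch. I §2 (unramified cohomology)] -/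
theorem localUnramified :
    ∀ (W : WeierstrassCurve ℚ) [W.IsElliptic] [W.IsGloballyMinimal] (p : ℕ) [Fact p.Prime]
      (κ : ZpExtension ℚ p) (γ : absoluteGaloisGroup ℚ),
      p ≠ 2 → W.HasIrreducibleModPGaloisRep p → ¬ W.HasSurjectiveModNGaloisRep p →
      κ.IsCyclotomic → κ.IsTopGenerator γ →
      ∀ (v : HeightOneSpectrum (𝓞 ℚ)), ((p : ℕ) : 𝓞 ℚ) ∉ v.asIdeal →
        GaloisRep.IsUnramifiedAt v (W.torsionGaloisModule (p : ℤ)) → W.HasGoodReductionAt v →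
        ∀ (J n : ℕ) (hJn : J + 1 ≤ p ^ n)
          (y : Literature.NumberTheory.EllipticCurves.subgroupH1 κ.kerSubgroup
            (WeierstrassCurve.geomTorsion W (p : ℤ))),
          W.torsionToPrimaryH1Sub p κ.kerSubgroup y ∈ W.fineSelmerInfty κ →
          ∀ (yn : Literature.NumberTheory.EllipticCurves.subgroupH1 (κ.invTwist.layerSubgroup n)
              (WeierstrassCurve.geomTorsion W (p : ℤ)))
            (Y : galoisCohomology (W.modPTwist p κ.invTwist (p ^ n)) 1)
            (Ψ : galoisCohomology (W.modPTwist p κ.invTwist (J + 1)) 1) (k : ℕ),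
            Literature.NumberTheory.EllipticCurves.resOfLe (WeierstrassCurve.geomTorsion W (p : ℤ))
                (κ.invTwist.kerSubgroup_le_layerSubgroup n) yn =
              Literature.NumberTheory.EllipticCurves.resOfLe (WeierstrassCurve.geomTorsion W (p : ℤ))
                (κ.kerSubgroup_unitTwist (-1)).le y →
            κ.invTwist.twistModPH1Equiv (W.torsionGaloisModule (p : ℤ))
              (fun P : WeierstrassCurve.geomTorsion W (p : ℤ) => AddSubgroup.torsionBy.nsmul P) n Y = yn →
            galoisCohomology.map (κ.invTwist.twistModPShiftEmbed (W.torsionGaloisModule (p : ℤ))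
              (fun P : WeierstrassCurve.geomTorsion W (p : ℤ) => AddSubgroup.torsionBy.nsmul P) (p ^ n) hJn)
                1 Ψ =
              (κ.invTwist.shiftH1 (W.torsionGaloisModule (p : ℤ))
                (fun P : WeierstrassCurve.geomTorsion W (p : ℤ) => AddSubgroup.torsionBy.nsmul P)
                (p ^ n))^[k] Y →
            galoisCohomology.localization (W.modPTwist p κ.invTwist (J + 1)) (Sum.inr v) 1 Ψ ∈
              DiscreteGaloisModule.unramifiedSubgroup
                (GaloisRep.toLocal v (W.modPTwist p κ.invTwist (J + 1))) 1 := by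
  intro W _ _ p _ κ _ _ _ _ _ _ v hvp hvur hgood J n hJn y hy yn Y Ψ k hyn hSh hΨemb
  letI : Fintype (absoluteGaloisGroup ℚ ⧸ κ.invTwist.layerSubgroup n) := κ.invTwist.fintypeQuotientLayer n
  -- notation
  set ρ : DiscreteGaloisModule ℚ (geomTorsion W (p : ℤ)) := W.torsionGaloisModule (p : ℤ) with hρ
  have hM : ∀ P : geomTorsion W (p : ℤ), p • P = 0 := fun P => AddSubgroup.torsionBy.nsmul P
  -- the inertia groups above `v` lie in `Gal(ℚ̄/ℚ_∞) = ker κ = ker κ⁻¹ ≤ Γ_n(κ⁻¹)`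
  have hIker : ∀ 𝔓 ∈ v.primesAbove, 𝔓.inertia (absoluteGaloisGroup ℚ) ≤ κ.kerSubgroup :=
    fun 𝔓 h𝔓 => ZpExtension.inertia_le_kerSubgroup_holds ℚ p κ hvp h𝔓
  have hIlayer : ∀ 𝔓 ∈ v.primesAbove,
      𝔓.inertia (absoluteGaloisGroup ℚ) ≤ κ.invTwist.layerSubgroup n := fun 𝔓 h𝔓 =>
    ((hIker 𝔓 h𝔓).trans (κ.kerSubgroup_unitTwist (-1)).ge).trans
      (κ.invTwist.kerSubgroup_le_layerSubgroup n)
  -- `E[p]` unramified at `v`: the inertia groups above `v` act trivially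
  have hfix : ∀ 𝔓 ∈ v.primesAbove, ∀ τ ∈ 𝔓.inertia (absoluteGaloisGroup ℚ),
      ∀ P : geomTorsion W (p : ℤ), τ • P = P := fun 𝔓 h𝔓 τ hτ P => by
    rw [← W.torsionGaloisModule_apply_apply (p : ℤ) τ P, hvur 𝔓 h𝔓 τ hτ]
    rfl
  -- STEP 1: `y` fine ⟹ `res_{I_𝔓} y = 0` (Castella (B′); good reduction at `v ∤ p`)
  have hfine : ∀ σ : absoluteGaloisGroup ℚ,
      W.conjH1 p κ.kerSubgroup σ (W.torsionToPrimaryH1Sub p κ.kerSubgroup y) ∈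
        GreenbergSelmer.awayKer κ.kerSubgroup (geomPrimaryTorsion W p) v :=
    fun σ => ((GreenbergSelmer.mem_strictSelmerGroupOver_iff _).1 hy).1 v hvp σ
  have hbad : v ∉ W.badPlaces (𝓞 ℚ) := fun h => (W.mem_badPlaces_iff v).1 h hgood
  have hres_y : ∀ 𝔓 (h𝔓 : 𝔓 ∈ v.primesAbove),
      Literature.NumberTheory.EllipticCurves.resOfLe (geomTorsion W (p : ℤ)) (hIker 𝔓 h𝔓) y = 0 :=
    fun 𝔓 h𝔓 => Castella2018.AcSelmer.resOfLe_torsion_eq_zero_of_forall_conjH1_mem_awayKer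
      (H := κ.kerSubgroup) hfine hbad hvp h𝔓 (hIker 𝔓 h𝔓)
  -- … transported to `y_n` (`res y_n = res y`)
  have hres_yn : ∀ 𝔓 (h𝔓 : 𝔓 ∈ v.primesAbove),
      Literature.NumberTheory.EllipticCurves.resOfLe (geomTorsion W (p : ℤ)) (hIlayer 𝔓 h𝔓) yn = 0 := by
    intro 𝔓 h𝔓
    have hI' : 𝔓.inertia (absoluteGaloisGroup ℚ) ≤ κ.invTwist.kerSubgroup :=
      (hIker 𝔓 h𝔓).trans (κ.kerSubgroup_unitTwist (-1)).ge
    have e1 : Literature.NumberTheory.EllipticCurves.resOfLe (geomTorsion W (p : ℤ)) (hIlayer 𝔓 h𝔓) yn =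
        Literature.NumberTheory.EllipticCurves.resOfLe (geomTorsion W (p : ℤ)) hI'
          (Literature.NumberTheory.EllipticCurves.resOfLe (geomTorsion W (p : ℤ))
            (κ.invTwist.kerSubgroup_le_layerSubgroup n) yn) := by
      rw [← AddMonoidHom.comp_apply, resOfLe_comp_holds (M := geomTorsion W (p : ℤ)) hI'
        (κ.invTwist.kerSubgroup_le_layerSubgroup n)]
    rw [e1, hyn, ← AddMonoidHom.comp_apply, resOfLe_comp_holds (M := geomTorsion W (p : ℤ)) hI'
      (κ.kerSubgroup_unitTwist (-1)).le]
    exact hres_y 𝔓 h𝔓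
  -- … and made pointwise on a cocycle `f` of `y_n` (`I_𝔓` acts trivially on `E[p]`)
  obtain ⟨f, hf⟩ :=
    oneCocycleClass_surjective (subgroupRep ρ.toTopRep (κ.invTwist.layerSubgroup n)) yn
  have hf0 : ∀ 𝔓 ∈ v.primesAbove, ∀ g : κ.invTwist.layerSubgroup n,
      (g : absoluteGaloisGroup ℚ) ∈ 𝔓.inertia (absoluteGaloisGroup ℚ) → f.1 g = 0 := by
    intro 𝔓 h𝔓 g hg
    have h0 := hres_yn 𝔓 h𝔓
    rw [← hf] at h0
    obtain ⟨a, ha⟩ := (resOfLe_oneCocycleClass_eq_zero_iff (M := geomTorsion W (p : ℤ))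
      (κ.invTwist.layerSubgroup n) (hIlayer 𝔓 h𝔓) f).1 h0
    have h1 := ha ⟨g, hg⟩
    rw [hfix 𝔓 h𝔓 g hg a, sub_self] at h1
    exact h1
  -- STEP 2: `Y = coresShapiro n y_n` has a cocycle `F` vanishing on every `I_𝔓`, `𝔓 ∣ v` (x9)
  obtain ⟨F, hF, hF0⟩ := CoresUnramified.exists_cocycle_coresShapiro_apply_eq_zero_of_forall_primesAbove
    κ.invTwist ρ hM n hvp f hf0
  rw [hf] at hF
  have hY : Y = κ.invTwist.coresShapiro ρ hM n yn := by
    rw [← hSh, κ.invTwist.coresShapiro_twistModPH1Equiv]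
  have hFY : oneCocycleClass _ F = Y := hF.trans hY.symm
  subst hFY
  -- STEP 3: every cocycle `ψ` of `Ψ` vanishes on every `I_𝔓`, `𝔓 ∣ v`
  obtain ⟨ψ, rfl⟩ := oneCocycleClass_surjective (W.modPTwist p κ.invTwist (J + 1)).toTopRep Ψ
  have hact : ∀ 𝔓 ∈ v.primesAbove, ∀ τ ∈ 𝔓.inertia (absoluteGaloisGroup ℚ),
      ∀ x : Fin (p ^ n) → geomTorsion W (p : ℤ), κ.invTwist.twistModP ρ hM (p ^ n) τ x = x := by
    intro 𝔓 h𝔓 τ hτ x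
    rw [κ.invTwist.twistModP_apply_of_mem_layerSubgroup ρ hM (p ^ n) (m := n)
      (Nat.lt_pow_self (Fact.out : p.Prime).one_lt).le le_rfl (hIlayer 𝔓 h𝔓 hτ)]
    funext i
    rw [hρ, W.torsionGaloisModule_apply_apply]
    exact hfix 𝔓 h𝔓 τ hτ (x i)
  have hψ0 : ∀ 𝔓 ∈ v.primesAbove, ∀ τ ∈ 𝔓.inertia (absoluteGaloisGroup ℚ), ψ.1 τ = 0 :=
    fun 𝔓 h𝔓 => apply_eq_zero_of_map_shiftEmbed_eq_shiftH1_iterate κ.invTwist ρ hM hJn k ψ F hΨemb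
      (hact 𝔓 h𝔓) (hF0 𝔓 h𝔓)
  -- STEP 4: a global cocycle vanishing on `I_{𝔓₀}` has unramified localisation (k6-g3)
  exact KolyvaginTwist.localization_mem_unramifiedSubgroup_of_forall_inertia_apply_eq_zero
    (W.modPTwist p κ.invTwist (J + 1)) v ψ (hψ0 _ (adicCompletionPrime_mem_primesAbove ℚ v))


/-! ## The registered stub from (L-p) alone -/

/-- **`stub_selmerDualOdd` (skeleton v6 of crux 19276, VERBATIM) from the single local hypothesis (L-p).**
k6-c2's assembly `stub_selmerDualOdd_of_local` re-run with (L-bad) DISCHARGED by `localBad` (p456573) and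
(L-ur) DISCHARGED by `localUnramified` (this file; the good reduction it wants is the middle component of
`TorsionUnramified.exists_finite_superset_isUnramifiedAt_torsionGaloisModule`, which the original assembly
discarded).  The hypothesis `hLp` is byte-identical to the assembly's: an exponent `ε_p` with
`loc_v (T^{ε'} Ψ) = 0` (`ε' ≥ ε_p`) at the place over `p` for every `Ψ` arising from a fine `y`.
[cite: GreenbergLNM1716, §3 Lemma 3.2] [cite: MazurRubin2004, §5.3] [cite: MilneADT2006, Ch. I, Thm. 4.10] -/
theorem stub_selmerDualOdd_of_localP
    (hLp : ∀ (W : WeierstrassCurve ℚ) [W.IsElliptic] [W.IsGloballyMinimal] (p : ℕ) [Fact p.Prime]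
      (κ : ZpExtension ℚ p) (γ : absoluteGaloisGroup ℚ),
      p ≠ 2 → W.HasIrreducibleModPGaloisRep p → ¬ W.HasSurjectiveModNGaloisRep p →
      κ.IsCyclotomic → κ.IsTopGenerator γ →
      (∀ v : HeightOneSpectrum (𝓞 ℚ), localEulerPoincareCharacteristic (v.adicCompletion ℚ)) →
      poitouTate_sum_localTatePairing_eq_zero ℚ →
      ∃ εp : ℕ, ∀ (v : HeightOneSpectrum (𝓞 ℚ)), ((p : ℕ) : 𝓞 ℚ) ∈ v.asIdeal →
        ∀ (J n : ℕ) (hJn : J + 1 ≤ p ^ n)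
          (y : Literature.NumberTheory.EllipticCurves.subgroupH1 κ.kerSubgroup
            (WeierstrassCurve.geomTorsion W (p : ℤ))),
          W.torsionToPrimaryH1Sub p κ.kerSubgroup y ∈ W.fineSelmerInfty κ →
          ∀ (yn : Literature.NumberTheory.EllipticCurves.subgroupH1 (κ.invTwist.layerSubgroup n)
              (WeierstrassCurve.geomTorsion W (p : ℤ)))
            (Y : galoisCohomology (W.modPTwist p κ.invTwist (p ^ n)) 1)
            (Ψ : galoisCohomology (W.modPTwist p κ.invTwist (J + 1)) 1) (k : ℕ),
            Literature.NumberTheory.EllipticCurves.resOfLe (WeierstrassCurve.geomTorsion W (p : ℤ))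
                (κ.invTwist.kerSubgroup_le_layerSubgroup n) yn =
              Literature.NumberTheory.EllipticCurves.resOfLe (WeierstrassCurve.geomTorsion W (p : ℤ))
                (κ.kerSubgroup_unitTwist (-1)).le y →
            κ.invTwist.twistModPH1Equiv (W.torsionGaloisModule (p : ℤ))
              (fun P : WeierstrassCurve.geomTorsion W (p : ℤ) => AddSubgroup.torsionBy.nsmul P) n Y = yn →
            galoisCohomology.map (κ.invTwist.twistModPShiftEmbed (W.torsionGaloisModule (p : ℤ))
              (fun P : WeierstrassCurve.geomTorsion W (p : ℤ) => AddSubgroup.torsionBy.nsmul P) (p ^ n) hJn)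
                1 Ψ =
              (κ.invTwist.shiftH1 (W.torsionGaloisModule (p : ℤ))
                (fun P : WeierstrassCurve.geomTorsion W (p : ℤ) => AddSubgroup.torsionBy.nsmul P)
                (p ^ n))^[k] Y →
            ∀ ε' : ℕ, εp ≤ ε' →
              galoisCohomology.localization (W.modPTwist p κ.invTwist (J + 1)) (Sum.inr v) 1
                ((κ.invTwist.shiftH1 (W.torsionGaloisModule (p : ℤ))
                  (fun P : WeierstrassCurve.geomTorsion W (p : ℤ) => AddSubgroup.torsionBy.nsmul P)
                  (J + 1))^[ε'] Ψ) = 0) :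
    ∀ (W : WeierstrassCurve ℚ) [W.IsElliptic] [W.IsGloballyMinimal] (p : ℕ) [Fact p.Prime]
      (κ : ZpExtension ℚ p) (γ : absoluteGaloisGroup ℚ),
      p ≠ 2 → W.HasIrreducibleModPGaloisRep p → ¬ W.HasSurjectiveModNGaloisRep p →
      κ.IsCyclotomic → κ.IsTopGenerator γ →
      (∀ v : HeightOneSpectrum (𝓞 ℚ), localEulerPoincareCharacteristic (v.adicCompletion ℚ)) →
      poitouTate_sum_localTatePairing_eq_zero ℚ →
      ∀ (S₀ : Set (HeightOneSpectrum (𝓞 ℚ))), S₀.Finite →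
      ∃ (ε : ℕ) (S : Set (HeightOneSpectrum (𝓞 ℚ))), S.Finite ∧ S₀ ⊆ S ∧
        ∀ (J : ℕ) (y : Literature.NumberTheory.EllipticCurves.subgroupH1 κ.kerSubgroup
            (WeierstrassCurve.geomTorsion W (p : ℤ))),
          W.torsionToPrimaryH1Sub p κ.kerSubgroup y ∈ W.fineSelmerInfty κ →
          (⇑(Literature.NumberTheory.EllipticCurves.conjH1 κ.kerSubgroup
              (WeierstrassCurve.geomTorsion W (p : ℤ)) γ -
            AddMonoidHom.id (Literature.NumberTheory.EllipticCurves.subgroupH1 κ.kerSubgroup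
              (WeierstrassCurve.geomTorsion W (p : ℤ)))))^[J] y ≠ 0 →
          ∃ Ψ : galoisCohomology (W.modPTwist p κ.invTwist (J + 1)) 1,
            (κ.invTwist.shiftH1 (W.torsionGaloisModule (p : ℤ))
                (fun P : WeierstrassCurve.geomTorsion W (p : ℤ) => AddSubgroup.torsionBy.nsmul P)
                (J + 1))^[J] Ψ ≠ 0 ∧
            (∀ v : HeightOneSpectrum (𝓞 ℚ), v ∉ S →
              galoisCohomology.localization (W.modPTwist p κ.invTwist (J + 1)) (Sum.inr v) 1 Ψ ∈
                DiscreteGaloisModule.unramifiedSubgroup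
                  (GaloisRep.toLocal v (W.modPTwist p κ.invTwist (J + 1))) 1) ∧
            (∀ v : HeightOneSpectrum (𝓞 ℚ), v ∈ S →
              galoisCohomology.localization (W.modPTwist p κ.invTwist (J + 1)) (Sum.inr v) 1
                ((κ.invTwist.shiftH1 (W.torsionGaloisModule (p : ℤ))
                  (fun P : WeierstrassCurve.geomTorsion W (p : ℤ) => AddSubgroup.torsionBy.nsmul P)
                  (J + 1))^[ε] Ψ) = 0) := by
  intro W _ _ p _ κ γ hp2 hirr hns hκ hγ hEP hPT S₀ hS₀
  have hp : p.Prime := Fact.out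
  -- the local inputs for this `(W, p, κ, γ)`
  have hbad := localBad W p κ γ hp2 hirr hns hκ hγ hEP hPT
  obtain ⟨εp, hpl⟩ := hLp W p κ γ hp2 hirr hns hκ hγ hEP hPT
  have hur := localUnramified W p κ γ hp2 hirr hns hκ hγ
  -- the exceptional set `S ⊇ S₀`: off `S`, `v ∤ p`, good reduction, `E[p]` unramified
  obtain ⟨S, hS, hS₀S, hSoff⟩ :=
    TorsionUnramified.exists_finite_superset_isUnramifiedAt_torsionGaloisModule W hp.ne_zero hS₀
  -- the uniform exponent: `ε = εp + max_{v ∈ S, v ∤ p} ε_v`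
  let f : HeightOneSpectrum (𝓞 ℚ) → ℕ := fun v =>
    if h : ((p : ℕ) : 𝓞 ℚ) ∉ v.asIdeal then Classical.choose (hbad v h) else 0
  have hf : ∀ (v : HeightOneSpectrum (𝓞 ℚ)) (h : ((p : ℕ) : 𝓞 ℚ) ∉ v.asIdeal)
      (J : ℕ) (c : galoisCohomology (W.modPTwist p κ.invTwist J) 1),
      galoisCohomology.localization (W.modPTwist p κ.invTwist J) (Sum.inr v) 1
        ((κ.invTwist.shiftH1 (W.torsionGaloisModule (p : ℤ))
          (fun P : WeierstrassCurve.geomTorsion W (p : ℤ) => AddSubgroup.torsionBy.nsmul P) J)^[f v] c) = 0 := by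
    intro v h J c
    have hfv : f v = Classical.choose (hbad v h) := dif_pos h
    rw [hfv]
    exact Classical.choose_spec (hbad v h) J c
  set ε : ℕ := εp + hS.toFinset.sup f with hεdef
  refine ⟨ε, S, hS, hS₀S, fun J y hy hyT => ?_⟩
  -- the algebraic half: `Y = Sh⁻¹(y_n)` at a layer `n` with `J + 1 ≤ p^n`, then the avatar `Ψ`
  obtain ⟨n₀, hn₀⟩ := exists_invTwist_class_of_iterate_ne_zero W p κ hγ J y hyT
  set n : ℕ := max n₀ (J + 1) with hndef
  have hJn : J + 1 ≤ p ^ n :=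
    le_trans (le_max_right n₀ (J + 1)) (Nat.lt_pow_self hp.one_lt).le
  obtain ⟨yn, Y, hyn, hSh, hYT⟩ := hn₀ n (le_max_left n₀ (J + 1))
  have hinv := LevelE.torsionGaloisModule_fixed_eq_zero_of_irr W p hirr
  obtain ⟨k, Ψ, hΨT, hΨemb⟩ := κ.invTwist.exists_level_class_of_shiftH1_iterate_ne_zero
    (W.torsionGaloisModule (p : ℤ)) (fun P => AddSubgroup.torsionBy.nsmul P) hinv hJn Y hYT
  refine ⟨Ψ, hΨT, fun v hv => ?_, fun v hv => ?_⟩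
  · -- unramified off `S`
    obtain ⟨hvp, hgood, hvur⟩ := hSoff v hv
    exact hur v hvp hvur hgood J n hJn y hy yn Y Ψ k hyn hSh hΨemb
  · -- `T^ε`-killed on `S`
    by_cases hvp : ((p : ℕ) : 𝓞 ℚ) ∈ v.asIdeal
    · exact hpl v hvp J n hJn y hy yn Y Ψ k hyn hSh hΨemb ε (Nat.le_add_right εp _)
    · have hfle : f v ≤ hS.toFinset.sup f := Finset.le_sup (hS.mem_toFinset.mpr hv)
      have hε : ε = f v + (ε - f v) := by omega
      rw [hε, Function.iterate_add_apply]
      exact hf v hvp (J + 1) _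


end Summit.BirchSwinnertonDyer.BirchSwinnertonDyer.Rank1Residual.SelmerDual

end
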